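import Literature.Topology.FourManifolds.LatticeFormsStableOrthogonalGroupIndexOriented
import Literature.Topology.FourManifolds.LatticeFormsOrientationCharacterDeterminant
import Literature.Topology.FourManifolds.LatticeFormsStableOrthogonalGroupNegId
import HarnessLib

/-!
# `[SO⁺(L) : S̃O⁺(L)] = [O⁺(L) : Õ⁺(L)] = |O(q_L)|` and `[O⁺(L) : SO⁺(L)] = [Õ⁺(L) : S̃O⁺(L)] = 2`
# (Gritsenko–Hulek–Sankaran, *Doc. Math.* 12 (2007) Lemma 4.2, bottom row and bottom vertical inclusions);
# `−id ∈ Õ⁺(L)` iff `L` is `2`-elementary and `n₊` is even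

Trunk T-4MAN vocabulary; the `SO⁺` companion of `LatticeFormsStableOrthogonalGroupIndex.lean` (row g39-#3: TOP row
`[O(L) : Õ(L)] = N = |O(q_L)|` of GHS 2007 Lemma 4.2 for even `L ≅ Q ⊕ U^{⊕r}`) and of
`LatticeFormsStableOrthogonalGroupIndexOriented.lean` (row g47-#6: MIDDLE row `[O⁺(L) : Õ⁺(L)] = N` by coset transfer along
`σ_v`, `v² = 2`; "the bottom row `SO⁺` of Lemma 4.2 [is] not in this file"), using the determinant theory of
`LatticeFormsOrientationCharacterDeterminant.lean` (row g48-#2: `det γ = ±1`, `det σ_r = −1`, `SO⁺(L) = O⁺(L) ∩ O⁺(L(−1))`;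
"NOT here: […] indices of GHS Lemma 4.2 beyond `[O⁺ : SO⁺] ≤ 2`") and `−id ∈ Õ(L) ⟺ L` is `2`-elementary
(`LatticeFormsStableOrthogonalGroupNegId.lean`). Written for lane `lit-hodgefound` (Track 2 foundations; prover seat
`lit-hodgefound-p18`, gen 48, row g48-#6). THEOREMS ONLY — no definition, no named fact, no instance, no notation.

## Source, verbatim

V. Gritsenko, K. Hulek, G. K. Sankaran, *The Hirzebruch–Mumford volume for the orthogonal group and applications*,
Doc. Math. 12 (2007) 215–241, §4.1 (held text `paper:arxiv-math_0512595` p. 9): "Finally the groups `SO⁺(L)` and `S̃O⁺(L)`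
are defined as the corresponding groups of isometries of determinant `1`. **Lemma 4.2.** Let `N = |O(q_L)|`. Then we have the
following diagram of groups with indices as indicated: `Õ(L) ⊂ O(L)` (`N:1`), `Õ⁺(L) ⊂ O⁺(L)` (`N:1`), `S̃O⁺(L) ⊂ SO⁺(L)`
(`N:1`) [vertical inclusions `2:1`]. *Proof.* We shall first prove that the indices of the vertical inclusions are all `2`. To
do this, we choose a hyperbolic plane `U` in `L`, which exists by assumption. Let `e₁, e₂` be a basis of `U` with
`e₁² = e₂² = 0` and `e₁.e₂ = 1`. If `u = e₁ − e₂`, `v = e₁ + e₂`, then `u² = −2`, `v² = 2` and the two reflections `σ_u` and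
`σ_v` belong to `Õ(L)`, since they act trivially on the orthogonal complement of `U`. Moreover `sn_{−1}(σ_v) = −1` and
`sn_{−1}(σ_u) = 1`. Hence we can use `σ_v` to conclude that the top two vertical inclusions are of index `2`, whereas `σ_u`
shows the same for the bottom two vertical inclusions. […] Taking into account that the reflections `σ_u` and `σ_v` act
trivially on the discriminant form, we obtain that `N = [O(L):Õ(L)] = [O⁺(L):Õ⁺(L)] = [SO⁺(L):S̃O⁺(L)]`. □ […] It follows
immediately from the above diagram that `[PO(L):PÕ⁺(L)] = N` if `−id ∉ Õ⁺(L)`, `2N` if `−id ∈ Õ⁺(L)`. Note that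
`−id ∈ Õ⁺(L)` if and only if `A_L` is a `2`-group." (There `L` has signature `(2, n)`.)

## Contents (all proved) and reading notes

* GROUPS, as in the sibling files: no quotient groups are formed — "`[Γ : Γ̃] = N`" is `Nat.card` of the classes of `Γ`
  under "same action on `A_L`" (`γ̄ = γ̄'`, the cosets of the stable subgroup), "`[Γ : SΓ] = 2`" is `Nat.card` of the
  classes of `Γ` under "same determinant" (the cosets of the determinant-`1` subgroup); `O⁺ = IsOrientationPreserving`,
  `S· = (det = 1)`.
* §1 **Determinant coset transfer** (`Q` any integral lattice form): if `σ ∈ O(L)` has `σ̄ = id` and `det σ = −1`, and a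
  family `P ⊆ O(L)` is stable under `γ ↦ γσ`, then the classes of `P` and of `P ∩ SO(L)` under "same action on `A_L`" are
  equinumerous (`natCard_quot_and_det_eq_one_eq_natCard_quot`) — the `σ_u`-half of the printed proof, once, abstractly.
* §2 **The witness `σ_u`, `u² = −2`: `σ_u ∈ Õ⁺(L)`, `det σ_u = −1`** (`Q` symmetric non-degenerate;
  `exists_isOrientationPreserving_and_discriminantGroupCongr_eq_refl_and_det_eq_neg_one`), hence the bottom vertical
  inclusions: **`[O⁺(L) : SO⁺(L)] = 2`** and **`[Õ⁺(L) : S̃O⁺(L)] = 2`** (`det` takes both values `±1` on `O⁺(L)`, on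
  `Õ⁺(L)`: `natCard_quot_isOrientationPreserving_det_eq`, `natCard_quot_isOrientationPreserving_and_congr_eq_refl_det_eq`),
  and `[O⁺(L) : Õ⁺(L)] = [SO⁺(L) : S̃O⁺(L)]` for every such `L` (`natCard_quot_isOrientationPreserving_and_det_eq_one_eq`).
* §3 **Lemma 4.2, bottom row: `[SO⁺(L) : S̃O⁺(L)] = N = |O(q_L)|`** for even non-degenerate `L ≅ Q ⊕ U^{⊕r}`, `r ≥ 1`
  (`natCard_quot_isOrientationPreserving_and_det_eq_one_eq_natCard_discriminantIsometry`; `u = e₁ − f₁ ∈ U`).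
* §4 **"`−id ∈ Õ⁺(L)` iff `A_L` is a `2`-group"**, read precisely for a symmetric non-degenerate `L` of any signature:
  `−id ∈ Õ(L) ∧ −id ∈ O⁺(L) ⟺ L` is `2`-elementary (`2A_L = 0`) `∧ n₊(L)` is even
  (`discriminantGroupCongr_neg_eq_refl_and_isOrientationPreserving_neg_iff`). SCOPE: the printed sentence is for
  signature `(2, n)`, where `n₊ = 2` makes the parity clause automatic, and "`2`-group" stands for "of exponent `2`"
  (`−id` acts as `−1` on `A_L`; `ℤ/4` is a `2`-group on which `−1 ≠ 1`) — the statement proved is the exact one.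
* §5 Models: `[SO⁺ : S̃O⁺] = 2^{ρ(d)}` for `Λ_d = ℓ^⊥ ⊂ Λ_{K3}` and for `L_{2d} = E₈(−1)^{⊕2} ⊕ U^{⊕2} ⊕ ⟨−2d⟩`.
* §6 (appended, row g48-#11) The TOP vertical inclusions **`[O(L) : O⁺(L)] = 2`** and **`[Õ(L) : Õ⁺(L)] = 2`** as class
  counts ("same orientation character" has exactly two classes on `O(L)`, on `Õ(L)`), as soon as `L` has a `(+2)`-vector
  `v` (`σ_v ∈ Õ(L)`, `sn_{−1}(σ_v) = −1`) — so that all six indices of the printed diagram are in the tree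
  (`natCard_quot_isOrientationPreserving_iff_eq_two`, `natCard_quot_congr_eq_refl_isOrientationPreserving_iff_eq_two`).

NOT here: the projective groups and `[PO(L) : PÕ⁺(L)] ∈ {N, 2N}` as an index of groups (its two ingredients, the diagram
and the `−id` criterion, are §3–§4); the stabiliser versions `O⁺(L, h)`.
-/

noncomputable section

open Module Function
open LinearMap (BilinForm)
open Literature.Topology.FourManifolds
open Literature.AlgebraicGeometry.Surfaces

namespace LinearMap.BilinForm

/-! ### §1 Determinant coset transfer -/

section Transfer

variable {L : Type*} [AddCommGroup L] [Module.Finite ℤ L] [Module.Free ℤ L] (Q : BilinForm ℤ L)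

omit [Module.Finite ℤ L] [Module.Free ℤ L] in
/-- The classes of `{γ | P γ}` under "`γ̄ = γ̄'`" are in bijection with the image `{γ̄ | P γ}` in `GL(A_L)`. [folklore] -/
private theorem natCard_quot_subtype_eq_natCard_range (P : Q.IsometryEquiv Q → Prop) :
    Nat.card (Quot fun γ γ' : {γ : Q.IsometryEquiv Q // P γ} ↦
        γ.1.discriminantGroupCongr = γ'.1.discriminantGroupCongr) =
      Nat.card {φ : Q.discriminantGroup ≃ₗ[ℤ] Q.discriminantGroup //
        ∃ γ : Q.IsometryEquiv Q, P γ ∧ γ.discriminantGroupCongr = φ} := by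
  refine Nat.card_eq_of_bijective
    (Quot.lift (fun γ : {γ : Q.IsometryEquiv Q // P γ} ↦
        (⟨γ.1.discriminantGroupCongr, γ.1, γ.2, rfl⟩ :
          {φ : Q.discriminantGroup ≃ₗ[ℤ] Q.discriminantGroup //
            ∃ γ : Q.IsometryEquiv Q, P γ ∧ γ.discriminantGroupCongr = φ}))
      (fun _ _ h ↦ Subtype.ext h)) ⟨?_, ?_⟩
  · rintro ⟨γ⟩ ⟨γ'⟩ h
    exact Quot.sound (Subtype.ext_iff.1 h)
  · rintro ⟨φ, γ, hγ, rfl⟩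
    exact ⟨Quot.mk _ ⟨γ, hγ⟩, rfl⟩

omit [Module.Finite ℤ L] [Module.Free ℤ L] in
/-- `det (γσ) = det σ · det γ` for `γ.trans σ = σ ∘ γ` (plumbing). [folklore] -/
private theorem IsometryEquiv.det_trans' (γ σ : Q.IsometryEquiv Q) :
    LinearMap.det ((γ.trans σ : Q.IsometryEquiv Q) : L →ₗ[ℤ] L) =
      LinearMap.det (σ : L →ₗ[ℤ] L) * LinearMap.det (γ : L →ₗ[ℤ] L) := by
  rw [show ((γ.trans σ : Q.IsometryEquiv Q) : L →ₗ[ℤ] L) = (σ : L →ₗ[ℤ] L) ∘ₗ (γ : L →ₗ[ℤ] L) from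
    LinearMap.ext fun _ ↦ rfl, LinearMap.det_comp]

omit [Module.Finite ℤ L] [Module.Free ℤ L] in
/-- **Determinant coset transfer** — the `σ_u`-half of GHS's proof of Lemma 4.2 ("`σ_u` shows the same for the bottom two
vertical inclusions […] Taking into account that the reflections `σ_u` and `σ_v` act trivially on the discriminant form, we
obtain that `N = […] = [SO⁺(L):S̃O⁺(L)]`"): let `σ ∈ O(L)` have `σ̄ = id` and `det σ = −1`, and let `P` be a family of
isometries stable under `γ ↦ γσ` (`γ.trans σ = σ ∘ γ`). Then the classes of `P` and of `P ∩ SO(L)` under "same action on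
`A_L`" are equinumerous: every class `γ̄`, `γ ∈ P`, `det γ = −1`, is also the class of `γσ ∈ P ∩ SO(L)`.
[cite: GritsenkoHulekSankaran2007HM, §4 proof of Lemma 4.2] -/
theorem natCard_quot_and_det_eq_one_eq_natCard_quot (P : Q.IsometryEquiv Q → Prop) (σ : Q.IsometryEquiv Q)
    (hσ : σ.discriminantGroupCongr = LinearEquiv.refl ℤ _) (hσ' : LinearMap.det (σ : L →ₗ[ℤ] L) = -1)
    (hP : ∀ γ, P γ → P (γ.trans σ)) :
    Nat.card (Quot fun γ γ' : {γ : Q.IsometryEquiv Q // P γ ∧ LinearMap.det (γ : L →ₗ[ℤ] L) = 1} ↦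
        γ.1.discriminantGroupCongr = γ'.1.discriminantGroupCongr) =
      Nat.card (Quot fun γ γ' : {γ : Q.IsometryEquiv Q // P γ} ↦
        γ.1.discriminantGroupCongr = γ'.1.discriminantGroupCongr) := by
  rw [natCard_quot_subtype_eq_natCard_range Q (fun γ ↦ P γ ∧ LinearMap.det (γ : L →ₗ[ℤ] L) = 1),
    natCard_quot_subtype_eq_natCard_range Q P]
  refine Nat.card_congr (Equiv.subtypeEquivRight fun φ ↦ ⟨?_, ?_⟩)
  · rintro ⟨γ, ⟨hγ, -⟩, hφ⟩
    exact ⟨γ, hγ, hφ⟩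
  · rintro ⟨γ, hγ, hφ⟩
    rcases IsometryEquiv.det_eq_one_or_eq_neg_one γ with hγ' | hγ'
    · exact ⟨γ, ⟨hγ, hγ'⟩, hφ⟩
    · refine ⟨γ.trans σ, ⟨hP γ hγ, ?_⟩, ?_⟩
      · rw [IsometryEquiv.det_trans', hσ', hγ']
        norm_num
      · rw [IsometryEquiv.discriminantGroupCongr_trans, hσ, LinearEquiv.trans_refl, hφ]

omit [Module.Finite ℤ L] [Module.Free ℤ L] in
/-- **"`[Γ : SΓ] = 2`"**: if a family `P ⊆ O(L)` contains an isometry of determinant `1` and one of determinant `−1`, the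
classes of `P` under "same determinant" number exactly `2` (`det γ = ±1` on `O(L)`).
[cite: GritsenkoHulekSankaran2007HM, §4 proof of Lemma 4.2 ("the indices of the vertical inclusions are all 2")] -/
theorem natCard_quot_det_eq_eq_two (P : Q.IsometryEquiv Q → Prop) (h₁ : ∃ γ, P γ ∧ LinearMap.det (γ : L →ₗ[ℤ] L) = 1)
    (h₂ : ∃ γ, P γ ∧ LinearMap.det (γ : L →ₗ[ℤ] L) = -1) :
    Nat.card (Quot fun γ γ' : {γ : Q.IsometryEquiv Q // P γ} ↦
        LinearMap.det (γ.1 : L →ₗ[ℤ] L) = LinearMap.det (γ'.1 : L →ₗ[ℤ] L)) = 2 := by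
  classical
  have hcard : Nat.card Bool = 2 := by simp
  rw [← hcard]
  refine Nat.card_eq_of_bijective
    (Quot.lift (fun γ : {γ : Q.IsometryEquiv Q // P γ} ↦ decide (LinearMap.det (γ.1 : L →ₗ[ℤ] L) = 1))
      (fun a b (h : LinearMap.det (a.1 : L →ₗ[ℤ] L) = LinearMap.det (b.1 : L →ₗ[ℤ] L)) ↦ by simp only [h]))
    ⟨?_, ?_⟩
  · rintro ⟨a⟩ ⟨b⟩ h
    have h' : decide (LinearMap.det (a.1 : L →ₗ[ℤ] L) = 1) = decide (LinearMap.det (b.1 : L →ₗ[ℤ] L) = 1) := h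
    apply Quot.sound
    rcases IsometryEquiv.det_eq_one_or_eq_neg_one a.1 with ha | ha <;>
      rcases IsometryEquiv.det_eq_one_or_eq_neg_one b.1 with hb | hb
    · rw [ha, hb]
    · rw [ha, hb] at h'
      simp at h'
    · rw [ha, hb] at h'
      simp at h'
    · rw [ha, hb]
  · intro b
    cases b
    · obtain ⟨γ, hγ, hd⟩ := h₂
      exact ⟨Quot.mk _ ⟨γ, hγ⟩, by simp [hd]⟩
    · obtain ⟨γ, hγ, hd⟩ := h₁
      exact ⟨Quot.mk _ ⟨γ, hγ⟩, by simp [hd]⟩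

end Transfer

/-! ### §2 The witness `σ_u`, `u² = −2`; `[O⁺(L) : SO⁺(L)] = [Õ⁺(L) : S̃O⁺(L)] = 2` -/

section Witness

variable {L : Type*} [AddCommGroup L] [Module.Finite ℤ L] [Module.Free ℤ L] (Q : BilinForm ℤ L)

/-- **`σ_u ∈ Õ⁺(L)` and `det σ_u = −1` for `u² = −2`** (`Q` symmetric non-degenerate): "the two reflections `σ_u` and
`σ_v` belong to `Õ(L)` […] `sn_{−1}(σ_u) = 1`", and a reflection has determinant `−1`.
[cite: GritsenkoHulekSankaran2007HM, §4 proof of Lemma 4.2] [cite: Huybrechts2016K3, Ch. 7 §5.4 ("+1 if (δ)² < 0")] -/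
theorem exists_isOrientationPreserving_and_discriminantGroupCongr_eq_refl_and_det_eq_neg_one (hQ : Q.IsSymm)
    (hnd : Q.Nondegenerate) {u : L} (hu : Q u u = -1 + -1) :
    ∃ σ : Q.IsometryEquiv Q, σ.IsOrientationPreserving ∧
      σ.discriminantGroupCongr = LinearEquiv.refl ℤ Q.discriminantGroup ∧ LinearMap.det (σ : L →ₗ[ℤ] L) = -1 :=
  ⟨normTwoReflectionEquiv hQ u (-1) hu (by norm_num),
    (isOrientationPreserving_normTwoReflectionEquiv_iff Q hQ hnd u (-1) hu (by norm_num)).2 rfl,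
    discriminantGroupCongr_normTwoReflectionEquiv Q hQ u (Or.inr rfl) hu (by norm_num),
    det_normTwoReflectionEquiv Q hQ u (-1) hu (by norm_num)⟩

/-- **`[O⁺(L) : SO⁺(L)] = 2`** as soon as `L` has a `(−2)`-vector (`Q` symmetric non-degenerate): `det` takes both values
`±1` on `O⁺(L)` (`id`, `σ_u`), so the classes of `O⁺(L)` under "same determinant" — the cosets of `SO⁺(L)` — number `2`.
[cite: GritsenkoHulekSankaran2007HM, §4 Lemma 4.2 (right column, bottom `2:1`) and its proof] -/
theorem natCard_quot_isOrientationPreserving_det_eq (hQ : Q.IsSymm) (hnd : Q.Nondegenerate) {u : L}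
    (hu : Q u u = -1 + -1) :
    Nat.card (Quot fun γ γ' : {γ : Q.IsometryEquiv Q // γ.IsOrientationPreserving} ↦
        LinearMap.det (γ.1 : L →ₗ[ℤ] L) = LinearMap.det (γ'.1 : L →ₗ[ℤ] L)) = 2 := by
  obtain ⟨σ, hσ₁, -, hσ₃⟩ :=
    Q.exists_isOrientationPreserving_and_discriminantGroupCongr_eq_refl_and_det_eq_neg_one hQ hnd hu
  refine Q.natCard_quot_det_eq_eq_two _ ⟨IsometryEquiv.refl Q, ?_, ?_⟩ ⟨σ, hσ₁, hσ₃⟩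
  · exact IsometryEquiv.IsOrientationPreserving.refl
  · rw [show ((IsometryEquiv.refl Q : Q.IsometryEquiv Q) : L →ₗ[ℤ] L) = LinearMap.id from LinearMap.ext fun _ ↦ rfl,
      LinearMap.det_id]

/-- **`[Õ⁺(L) : S̃O⁺(L)] = 2`** as soon as `L` has a `(−2)`-vector (`Q` symmetric non-degenerate): `det` takes both values
`±1` on `Õ⁺(L) = Õ(L) ∩ O⁺(L)` (`id`, `σ_u`). [cite: GritsenkoHulekSankaran2007HM, §4 Lemma 4.2 (left column, bottom `2:1`) and its proof] -/
theorem natCard_quot_isOrientationPreserving_and_congr_eq_refl_det_eq (hQ : Q.IsSymm) (hnd : Q.Nondegenerate) {u : L}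
    (hu : Q u u = -1 + -1) :
    Nat.card (Quot fun γ γ' : {γ : Q.IsometryEquiv Q // γ.IsOrientationPreserving ∧
          γ.discriminantGroupCongr = LinearEquiv.refl ℤ Q.discriminantGroup} ↦
        LinearMap.det (γ.1 : L →ₗ[ℤ] L) = LinearMap.det (γ'.1 : L →ₗ[ℤ] L)) = 2 := by
  obtain ⟨σ, hσ₁, hσ₂, hσ₃⟩ :=
    Q.exists_isOrientationPreserving_and_discriminantGroupCongr_eq_refl_and_det_eq_neg_one hQ hnd hu
  refine Q.natCard_quot_det_eq_eq_two _ ⟨IsometryEquiv.refl Q, ⟨?_, ?_⟩, ?_⟩ ⟨σ, ⟨hσ₁, hσ₂⟩, hσ₃⟩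
  · exact IsometryEquiv.IsOrientationPreserving.refl
  · exact IsometryEquiv.discriminantGroupCongr_refl
  · rw [show ((IsometryEquiv.refl Q : Q.IsometryEquiv Q) : L →ₗ[ℤ] L) = LinearMap.id from LinearMap.ext fun _ ↦ rfl,
      LinearMap.det_id]

/-- **`[SO⁺(L) : S̃O⁺(L)] = [O⁺(L) : Õ⁺(L)]`** as soon as `L` has a `(−2)`-vector `u` (`Q` symmetric non-degenerate): the
classes of `SO⁺(L)` and of `O⁺(L)` under "same action on `A_L`" are equinumerous — §1 along `σ_u ∈ Õ⁺(L)`, which keeps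
`O⁺(L)` stable. [cite: GritsenkoHulekSankaran2007HM, §4 proof of Lemma 4.2 ("N = […] = [O⁺(L):Õ⁺(L)] = [SO⁺(L):S̃O⁺(L)]")] -/
theorem natCard_quot_isOrientationPreserving_and_det_eq_one_eq (hQ : Q.IsSymm) (hnd : Q.Nondegenerate) {u : L}
    (hu : Q u u = -1 + -1) :
    Nat.card (Quot fun γ γ' : {γ : Q.IsometryEquiv Q // γ.IsOrientationPreserving ∧
          LinearMap.det (γ : L →ₗ[ℤ] L) = 1} ↦ γ.1.discriminantGroupCongr = γ'.1.discriminantGroupCongr) =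
      Nat.card (Quot fun γ γ' : {γ : Q.IsometryEquiv Q // γ.IsOrientationPreserving} ↦
        γ.1.discriminantGroupCongr = γ'.1.discriminantGroupCongr) := by
  obtain ⟨σ, hσ₁, hσ₂, hσ₃⟩ :=
    Q.exists_isOrientationPreserving_and_discriminantGroupCongr_eq_refl_and_det_eq_neg_one hQ hnd hu
  exact Q.natCard_quot_and_det_eq_one_eq_natCard_quot IsometryEquiv.IsOrientationPreserving σ hσ₂ hσ₃
    fun γ hγ ↦ (IsometryEquiv.isOrientationPreserving_trans_iff hQ hnd γ σ).2 (iff_of_true hσ₁ hγ)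

end Witness

/-! ### §3 GHS 2007 Lemma 4.2, bottom row: `[SO⁺(L) : S̃O⁺(L)] = N = |O(q_L)|` -/

section HyperbolicPlane

variable {M : Type*} [AddCommGroup M] [Module.Finite ℤ M] [Module.Free ℤ M] (B : BilinForm ℤ M)

/-- **GHS Lemma 4.2, bottom row: `[SO⁺(L) : S̃O⁺(L)] = N = |O(q_L)|`** for an even non-degenerate lattice
`L ≅ Q ⊕ U^{⊕r}` (`r ≥ 1`, "`L` contains a hyperbolic plane"): the classes of the orientation-preserving isometries OF
DETERMINANT `1` with the same action on the discriminant group (= the cosets of `S̃O⁺(L) = Õ(L) ∩ SO⁺(L)` in `SO⁺(L)`) are in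
bijection with `O(q_L)` — by the middle row (companion file) and the determinant coset transfer along `σ_u`,
`u = e₁ − e₂ ∈ U`, `u² = −2`, `σ_u ∈ Õ⁺(L)`.
[cite: GritsenkoHulekSankaran2007HM, §4 Lemma 4.2 ("`S̃O⁺(L) ⊂ SO⁺(L)`, `N:1`") and its proof] [cite: Nikulin1980, Thm. 1.14.2] -/
theorem natCard_quot_isOrientationPreserving_and_det_eq_one_eq_natCard_discriminantIsometry (hB : B.Nondegenerate)
    (hs : B.IsSymm) (he : B.IsEven) {N : Type*} [AddCommGroup N] [Module.Finite ℤ N] [Module.Free ℤ N]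
    (Q : BilinForm ℤ N) (hQ : Q.Nondegenerate) (hsQ : Q.IsSymm) (heQ : Q.IsEven) {r : ℕ} (hr : 0 < r)
    (hBQ : B.Equivalent (Q.prod (hyperbolicSum r))) :
    Nat.card (Quot fun g g' : {g : B.IsometryEquiv B // g.IsOrientationPreserving ∧
          LinearMap.det (g : M →ₗ[ℤ] M) = 1} ↦ g.1.discriminantGroupCongr = g'.1.discriminantGroupCongr) =
      Nat.card {σ : B.discriminantGroup ≃ₗ[ℤ] B.discriminantGroup //
        ∀ a, B.discriminantQuad hB hs he (σ a) = B.discriminantQuad hB hs he a} := by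
  obtain ⟨e⟩ := hBQ
  -- the `(−2)`-vector `u = e⁻¹(0, e₁ − f₁)`
  have hu : B (e.symm ((0 : N), ((Pi.single ⟨0, hr⟩ 1 : Fin r → ℤ), (-Pi.single ⟨0, hr⟩ 1 : Fin r → ℤ))))
      (e.symm ((0 : N), ((Pi.single ⟨0, hr⟩ 1 : Fin r → ℤ), (-Pi.single ⟨0, hr⟩ 1 : Fin r → ℤ)))) = -1 + -1 := by
    rw [← e.map_app, IsometryEquiv.apply_symm_apply]
    simp [LinearMap.BilinForm.prod_apply]
  rw [← natCard_quot_isOrientationPreserving_eq_natCard_discriminantIsometry B hB hs he Q hQ hsQ heQ hr ⟨e⟩]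
  exact B.natCard_quot_isOrientationPreserving_and_det_eq_one_eq hs hB hu

end HyperbolicPlane

/-! ### §4 `−id ∈ Õ⁺(L)` iff `L` is `2`-elementary and `n₊` is even -/

section NegId

variable {L : Type*} [AddCommGroup L] [Module.Finite ℤ L] [Module.Free ℤ L] (Q : BilinForm ℤ L)

/-- **"`−id ∈ Õ⁺(L)` if and only if `A_L` is a `2`-group"**, precisely, for a symmetric non-degenerate `L` of any
signature: `−id ∈ Õ(L)` (`(−id)‾ = id_{A_L}`) and `−id ∈ O⁺(L)` iff `L` is `2`-elementary (`2·A_L = 0`) and `n₊(L)` is even.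
For GHS's `L` of signature `(2, n)` the parity clause holds automatically; "`2`-group" is to be read "of exponent `2`"
(`−id` acts on `A_L` as `−1`). [cite: GritsenkoHulekSankaran2007HM, §4 after Lemma 4.2] [cite: Huybrechts2016K3, Ch. 7 §5.4 Thm. 5.7 (−id ∉ O⁺ for n₊ = 3)] -/
theorem discriminantGroupCongr_neg_eq_refl_and_isOrientationPreserving_neg_iff (hQ : Q.IsSymm)
    (hnd : Q.Nondegenerate) :
    ((IsometryEquiv.neg Q).discriminantGroupCongr = LinearEquiv.refl ℤ Q.discriminantGroup ∧
        (IsometryEquiv.neg Q).IsOrientationPreserving) ↔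
      Q.IsTwoElementary ∧ Even (sigPos Q.toQuadraticMap) := by
  rw [discriminantGroupCongr_neg_eq_refl_iff_isTwoElementary Q, IsometryEquiv.isOrientationPreserving_neg_iff Q hQ hnd]

/-- In particular for `n₊(L)` even (e.g. GHS's signature `(2, n)`): `−id ∈ Õ⁺(L) ⟺ L` is `2`-elementary.
[cite: GritsenkoHulekSankaran2007HM, §4 after Lemma 4.2 ("−id ∈ Õ⁺(L) if and only if A_L is a 2-group")] -/
theorem discriminantGroupCongr_neg_eq_refl_and_isOrientationPreserving_neg_iff_of_even (hQ : Q.IsSymm)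
    (hnd : Q.Nondegenerate) (hev : Even (sigPos Q.toQuadraticMap)) :
    ((IsometryEquiv.neg Q).discriminantGroupCongr = LinearEquiv.refl ℤ Q.discriminantGroup ∧
        (IsometryEquiv.neg Q).IsOrientationPreserving) ↔ Q.IsTwoElementary := by
  rw [Q.discriminantGroupCongr_neg_eq_refl_and_isOrientationPreserving_neg_iff hQ hnd]
  exact ⟨fun h ↦ h.1, fun h ↦ ⟨h, hev⟩⟩

end NegId

end LinearMap.BilinForm

/-! ### §5 Models: `[SO⁺ : S̃O⁺] = 2^{ρ(d)}` for `Λ_d ⊂ Λ_{K3}` and `L_{2d}` -/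

namespace Literature.Topology.FourManifolds

open LinearMap.BilinForm

section K3

variable (d : ℕ)

/-- **`[SO⁺(Λ_d) : S̃O⁺(Λ_d)] = 2^{ρ(d)}`** for `Λ_d = ℓ^⊥ ⊂ Λ_{K3}`, `ℓ` primitive with `(ℓ)² = 2d > 0`
(`ℓ^⊥ ≅ L_{2d} ⊃ U^{⊕2}`, `N = |O(q_{L_{2d}})| = 2^{ρ(d)}`).
[cite: GritsenkoHulekSankaran2007HM, §4 Lemma 4.2 (bottom row), Lemma 4.3] [cite: Huybrechts2016K3, Ch. 14 Cor. 2.7 and Example 1.11 (i)] -/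
theorem natCard_quot_isOrientationPreserving_and_det_eq_one_k3Lattice_orthogonal (hd : 0 < d) {ℓ : K3Index → ℤ}
    (hℓ : Matrix.toBilin' k3Gram ℓ ℓ = 2 * d)
    (hℓsat : ∀ (k : ℤ) (w : K3Index → ℤ), k ≠ 0 → k • w ∈ ℤ ∙ ℓ → w ∈ ℤ ∙ ℓ) :
    Nat.card (Quot fun g g' : {g : ((Matrix.toBilin' k3Gram).restrict
          ((Matrix.toBilin' k3Gram).orthogonal (ℤ ∙ ℓ))).IsometryEquiv
        ((Matrix.toBilin' k3Gram).restrict ((Matrix.toBilin' k3Gram).orthogonal (ℤ ∙ ℓ))) //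
          g.IsOrientationPreserving ∧
            LinearMap.det (g : ((Matrix.toBilin' k3Gram).orthogonal (ℤ ∙ ℓ)) →ₗ[ℤ]
              ((Matrix.toBilin' k3Gram).orthogonal (ℤ ∙ ℓ))) = 1} ↦
        g.1.discriminantGroupCongr = g'.1.discriminantGroupCongr) = 2 ^ d.primeFactors.card := by
  have hℓ0 : ℓ ≠ 0 := by
    intro h0
    subst h0
    simp only [map_zero] at hℓ
    omega
  obtain ⟨hsC, heC, hC⟩ := k3Lattice_restrict_orthogonal_isEven_nondegenerate hℓ (by exact_mod_cast hd.ne') hℓsat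
  obtain ⟨e⟩ := k3Lattice_restrict_orthogonal_equivalent hℓ hℓ0 hℓsat
  obtain ⟨hQ, hsQ, heQ⟩ := nondegenerate_isSymm_isEven_neg_twoMul_smul_mul_prod_pi_neg_e8Form d hd
  obtain ⟨e'⟩ := latticeL2d_equivalent_prod_hyperbolicSum d
  rw [natCard_quot_isOrientationPreserving_and_det_eq_one_eq_natCard_discriminantIsometry _ hC hsC heC _ hQ hsQ heQ
    (by norm_num : 0 < 2) ⟨e.trans e'⟩]
  exact natCard_discriminantIsometry_restrict_orthogonal d _ isSymm_toBilin'_k3Gram isUnimodular_toBilin'_k3Gram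
    isEven_toBilin'_k3Gram hd hℓ hℓsat hC hsC heC

/-- **`[SO⁺(L_{2d}) : S̃O⁺(L_{2d})] = 2^{ρ(d)}`** for the model `L_{2d} = E₈(−1)^{⊕2} ⊕ U^{⊕2} ⊕ ℤ(−2d)` (`d ≥ 1`).
[cite: GritsenkoHulekSankaran2007HM, §4 Lemmas 4.2 (bottom row), 4.3] -/
theorem natCard_quot_isOrientationPreserving_and_det_eq_one_latticeL2d (hd : 0 < d) :
    Nat.card (Quot fun g g' : {g : (((LinearMap.BilinForm.pi fun _ : Fin 2 ↦ -e8Form).prod (hyperbolicSum 2)).prod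
          ((-(2 * d : ℤ)) • LinearMap.mul ℤ ℤ)).IsometryEquiv
        (((LinearMap.BilinForm.pi fun _ : Fin 2 ↦ -e8Form).prod (hyperbolicSum 2)).prod
          ((-(2 * d : ℤ)) • LinearMap.mul ℤ ℤ)) //
          g.IsOrientationPreserving ∧
            LinearMap.det (g : (((Fin 2 → Fin 8 → ℤ) × ((Fin 2 → ℤ) × (Fin 2 → ℤ))) × ℤ) →ₗ[ℤ]
              (((Fin 2 → Fin 8 → ℤ) × ((Fin 2 → ℤ) × (Fin 2 → ℤ))) × ℤ)) = 1} ↦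
        g.1.discriminantGroupCongr = g'.1.discriminantGroupCongr) = 2 ^ d.primeFactors.card := by
  obtain ⟨hQ, hsQ, heQ⟩ := nondegenerate_isSymm_isEven_neg_twoMul_smul_mul_prod_pi_neg_e8Form d hd
  obtain ⟨e⟩ := latticeL2d_equivalent_prod_hyperbolicSum d
  have h₁ := e.symm.nondegenerate (hQ.prod (isUnimodular_hyperbolicSum 2).nondegenerate)
  have h₂ := e.symm.isSymm (hsQ.prod (isSymm_hyperbolicSum 2))
  have h₃ := e.symm.isEven (isEven_prod_iff.2 ⟨heQ, isEven_hyperbolicSum 2⟩)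
  rw [natCard_quot_isOrientationPreserving_and_det_eq_one_eq_natCard_discriminantIsometry _ h₁ h₂ h₃ _ hQ hsQ heQ
    (by norm_num : 0 < 2) ⟨e⟩]
  exact natCard_discriminantIsometry_latticeL2d d hd h₁ h₂ h₃

end K3

end Literature.Topology.FourManifolds

/-! ### §6 The top vertical inclusions: `[O(L) : O⁺(L)] = [Õ(L) : Õ⁺(L)] = 2` -/

namespace LinearMap.BilinForm

section TopVertical

variable {L : Type*} [AddCommGroup L] [Module.Finite ℤ L] [Module.Free ℤ L] (Q : BilinForm ℤ L)

/-- **"`[Γ : Γ⁺] = 2`"**: if a family `P ⊆ O(L)` contains an orientation-preserving and an orientation-reversing isometry,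
the classes of `P` under "same orientation character" number exactly `2`.
[cite: GritsenkoHulekSankaran2007HM, §4 proof of Lemma 4.2 ("the indices of the vertical inclusions are all 2")] -/
theorem natCard_quot_isOrientationPreserving_iff_eq_two_of_exists (P : Q.IsometryEquiv Q → Prop)
    (h₁ : ∃ γ, P γ ∧ γ.IsOrientationPreserving) (h₂ : ∃ γ, P γ ∧ ¬ γ.IsOrientationPreserving) :
    Nat.card (Quot fun γ γ' : {γ : Q.IsometryEquiv Q // P γ} ↦
        (γ.1.IsOrientationPreserving ↔ γ'.1.IsOrientationPreserving)) = 2 := by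
  classical
  have hcard : Nat.card Bool = 2 := by simp
  rw [← hcard]
  refine Nat.card_eq_of_bijective
    (Quot.lift (fun γ : {γ : Q.IsometryEquiv Q // P γ} ↦ decide γ.1.IsOrientationPreserving)
      (fun a b (h : a.1.IsOrientationPreserving ↔ b.1.IsOrientationPreserving) ↦ by simp only [h]))
    ⟨?_, ?_⟩
  · rintro ⟨a⟩ ⟨b⟩ h
    have h' : decide a.1.IsOrientationPreserving = decide b.1.IsOrientationPreserving := h
    apply Quot.sound
    by_cases ha : a.1.IsOrientationPreserving <;> by_cases hb : b.1.IsOrientationPreserving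
    · exact iff_of_true ha hb
    · rw [decide_eq_true ha, decide_eq_false hb] at h'
      cases h'
    · rw [decide_eq_false ha, decide_eq_true hb] at h'
      cases h'
    · exact iff_of_false ha hb
  · intro b
    cases b
    · obtain ⟨γ, hγ, hd⟩ := h₂
      exact ⟨Quot.mk _ ⟨γ, hγ⟩, by simp [hd]⟩
    · obtain ⟨γ, hγ, hd⟩ := h₁
      exact ⟨Quot.mk _ ⟨γ, hγ⟩, by simp [hd]⟩

/-- **`[O(L) : O⁺(L)] = 2`** as soon as `L` has a `(+2)`-vector `v` (`Q` symmetric non-degenerate): `id ∈ O⁺`,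
`σ_v ∉ O⁺` ("`sn_{−1}(σ_v) = −1`"), so the orientation character takes both values on `O(L)`.
[cite: GritsenkoHulekSankaran2007HM, §4 Lemma 4.2 (right column, top `2:1`) and its proof] [cite: Huybrechts2016K3, Ch. 7 §5.4 ("index two subgroup")] -/
theorem natCard_quot_isOrientationPreserving_iff_eq_two (hQ : Q.IsSymm) (hnd : Q.Nondegenerate) {v : L}
    (hv : Q v v = 1 + 1) :
    Nat.card (Quot fun γ γ' : Q.IsometryEquiv Q ↦ (γ.IsOrientationPreserving ↔ γ'.IsOrientationPreserving)) = 2 := by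
  rw [← Q.natCard_quot_isOrientationPreserving_iff_eq_two_of_exists (fun _ ↦ True)
    ⟨IsometryEquiv.refl Q, trivial, IsometryEquiv.IsOrientationPreserving.refl⟩
    ⟨normTwoReflectionEquiv hQ v 1 hv (one_mul 1), trivial, by
      rw [isOrientationPreserving_normTwoReflectionEquiv_iff Q hQ hnd v 1 hv (one_mul 1)]; norm_num⟩]
  exact (Nat.card_congr (Quot.congr
    (rb := fun γ γ' : Q.IsometryEquiv Q ↦ (γ.IsOrientationPreserving ↔ γ'.IsOrientationPreserving))
    (Equiv.subtypeUnivEquiv fun _ : Q.IsometryEquiv Q ↦ trivial) (fun _ _ ↦ Iff.rfl))).symm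

/-- **`[Õ(L) : Õ⁺(L)] = 2`** as soon as `L` has a `(+2)`-vector `v` (`Q` symmetric non-degenerate): `σ_v ∈ Õ(L) ∖ O⁺(L)`
("the two reflections `σ_u` and `σ_v` belong to `Õ(L)` […] `sn_{−1}(σ_v) = −1`").
[cite: GritsenkoHulekSankaran2007HM, §4 Lemma 4.2 (left column, top `2:1`) and its proof] -/
theorem natCard_quot_congr_eq_refl_isOrientationPreserving_iff_eq_two (hQ : Q.IsSymm) (hnd : Q.Nondegenerate) {v : L}
    (hv : Q v v = 1 + 1) :
    Nat.card (Quot fun γ γ' : {γ : Q.IsometryEquiv Q //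
          γ.discriminantGroupCongr = LinearEquiv.refl ℤ Q.discriminantGroup} ↦
        (γ.1.IsOrientationPreserving ↔ γ'.1.IsOrientationPreserving)) = 2 :=
  Q.natCard_quot_isOrientationPreserving_iff_eq_two_of_exists _
    ⟨IsometryEquiv.refl Q, IsometryEquiv.discriminantGroupCongr_refl, IsometryEquiv.IsOrientationPreserving.refl⟩
    ⟨normTwoReflectionEquiv hQ v 1 hv (one_mul 1),
      discriminantGroupCongr_normTwoReflectionEquiv Q hQ v (Or.inl rfl) hv (one_mul 1), by
      rw [isOrientationPreserving_normTwoReflectionEquiv_iff Q hQ hnd v 1 hv (one_mul 1)]; norm_num⟩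

/-- **All four vertical `2:1`'s need `U ⊂ L`**: for an even non-degenerate `L ≅ Q ⊕ U^{⊕r}`, `r ≥ 1`, both `v = e₁ + f₁`
(`v² = 2`) and `u = e₁ − f₁` (`u² = −2`) are available, so `[O:O⁺] = [Õ:Õ⁺] = [O⁺:SO⁺] = [Õ⁺:S̃O⁺] = 2`.
[cite: GritsenkoHulekSankaran2007HM, §4 Lemma 4.2 and its proof ("we choose a hyperbolic plane U in L, which exists by assumption")] -/
theorem natCard_quot_vertical_eq_two {M : Type*} [AddCommGroup M] [Module.Finite ℤ M] [Module.Free ℤ M]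
    (B : BilinForm ℤ M) (hB : B.Nondegenerate) (hs : B.IsSymm) {N : Type*} [AddCommGroup N] (Q' : BilinForm ℤ N)
    {r : ℕ} (hr : 0 < r) (hBQ : B.Equivalent (Q'.prod (hyperbolicSum r))) :
    Nat.card (Quot fun γ γ' : B.IsometryEquiv B ↦ (γ.IsOrientationPreserving ↔ γ'.IsOrientationPreserving)) = 2 ∧
      Nat.card (Quot fun γ γ' : {γ : B.IsometryEquiv B //
            γ.discriminantGroupCongr = LinearEquiv.refl ℤ B.discriminantGroup} ↦
          (γ.1.IsOrientationPreserving ↔ γ'.1.IsOrientationPreserving)) = 2 ∧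
      Nat.card (Quot fun γ γ' : {γ : B.IsometryEquiv B // γ.IsOrientationPreserving} ↦
          LinearMap.det (γ.1 : M →ₗ[ℤ] M) = LinearMap.det (γ'.1 : M →ₗ[ℤ] M)) = 2 ∧
      Nat.card (Quot fun γ γ' : {γ : B.IsometryEquiv B // γ.IsOrientationPreserving ∧
            γ.discriminantGroupCongr = LinearEquiv.refl ℤ B.discriminantGroup} ↦
          LinearMap.det (γ.1 : M →ₗ[ℤ] M) = LinearMap.det (γ'.1 : M →ₗ[ℤ] M)) = 2 := by
  obtain ⟨e⟩ := hBQ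
  have hv : B (e.symm ((0 : N), ((Pi.single ⟨0, hr⟩ 1 : Fin r → ℤ), (Pi.single ⟨0, hr⟩ 1 : Fin r → ℤ))))
      (e.symm ((0 : N), ((Pi.single ⟨0, hr⟩ 1 : Fin r → ℤ), (Pi.single ⟨0, hr⟩ 1 : Fin r → ℤ)))) = 1 + 1 := by
    rw [← e.map_app, IsometryEquiv.apply_symm_apply]
    simp [LinearMap.BilinForm.prod_apply]
  have hu : B (e.symm ((0 : N), ((Pi.single ⟨0, hr⟩ 1 : Fin r → ℤ), (-Pi.single ⟨0, hr⟩ 1 : Fin r → ℤ))))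
      (e.symm ((0 : N), ((Pi.single ⟨0, hr⟩ 1 : Fin r → ℤ), (-Pi.single ⟨0, hr⟩ 1 : Fin r → ℤ)))) = -1 + -1 := by
    rw [← e.map_app, IsometryEquiv.apply_symm_apply]
    simp [LinearMap.BilinForm.prod_apply]
  exact ⟨B.natCard_quot_isOrientationPreserving_iff_eq_two hs hB hv,
    B.natCard_quot_congr_eq_refl_isOrientationPreserving_iff_eq_two hs hB hv,
    B.natCard_quot_isOrientationPreserving_det_eq hs hB hu,
    B.natCard_quot_isOrientationPreserving_and_congr_eq_refl_det_eq hs hB hu⟩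

end TopVertical

end LinearMap.BilinForm
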